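import Summits.QuantumFields.QCD.Theorems.HeatSlicedQuarksQuarkLoopCoefficientFreeMajorantToolkitAuxC
import Summits.QuantumFields.QCD.Theorems.HeatSlicedQuarksQuarkLoopCoefficientFreeMajorantToolkitAuxF

/-!
# Quark-loop coefficient (item stmt-QuantumFields-16786), line `Sketch`: stub `freeMajorantToolkit`

The free majorant toolkit of the line `Sketch` of the crux `QuarkLoopCoefficient`
(`Summit.QuantumFields.QCD.Theses.HeatSlicedQuarks.QuarkLoopCoefficient`): the six conjuncts

1. the free Gaussian bound `|k_t(w)| ≤ C Γ_c(t, w)` of the free Wilson heat kernel on `ℤ⁴`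
   (contour shift of the Brillouin-zone integral, part F);
2. the mixed convolution `Σ_y Γ_{(1−ε)c}(a, y) Γ_c(b, w−y) ≤ B Γ_{(1−ε)c}(a+b, w)` (part C);
3. moments `|w|ʲ Γ_c ≤ A (1+t)^{j/2} Γ_{(1−ε)c}` (part B);
4. bounded shifts `Γ_c(t, w+z) ≤ A Γ_{(1−ε)c}(t, w)`, `|z| ≤ 2` (part B);
5. the mass bound `Σ_y Γ_c(t, y) ≤ A` (part B);
6. the image sum `Σ_{n≠0} Γ_c(t, L•n) ≤ C e^{−(c/2)L²/(t+L)}/t²` for `1 ≤ t ≤ L²` (part B),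

where `Γ_c(t, w) = (1+t)⁻² exp(−c|w|²/(1+t+|w|))` is `gaussProfile c t w`.  All proofs are in the
helper files `…FreeMajorantToolkitAux*.lean`; this file only assembles the registered statement.
-/

namespace Summit.QuantumFields.QCD.Cruxes.QuarkLoopCoefficient.Sketch

open Summit.QuantumFields.QCD.Theorems.QuarkLoopCoefficient
open Literature.MathematicalPhysics.QuantumLattice Literature.MathematicalPhysics.QuantumFieldTheory
open Literature.Probability.LatticeModels (Site TorusSite)
open scoped Matrix ComplexConjugate

/-- The free majorant toolkit (stub `stub_freeMajorantToolkit` of the line `Sketch`): the free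
Gaussian bound, the mixed convolution, moments, shifts, mass and image sum of the two-regime
Gaussian majorant `gaussProfile`. -/
theorem stub_freeMajorantToolkit :
    ((∃ C c : ℝ, 0 < c ∧ ∀ t : ℝ, 0 ≤ t → ∀ w : Site 4, |freeKer t w| ≤ C * gaussProfile c t w) ∧
      (∀ c ε : ℝ, 0 < c → 0 < ε → ε < 1 → ∃ B : ℝ, ∀ a b : ℝ, 0 ≤ a → 0 ≤ b → ∀ w : Site 4,
        Summable (fun y : Site 4 => gaussProfile ((1 - ε) * c) a y * gaussProfile c b (w - y)) ∧
        ∑' y : Site 4, gaussProfile ((1 - ε) * c) a y * gaussProfile c b (w - y) ≤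
          B * gaussProfile ((1 - ε) * c) (a + b) w) ∧
      (∀ c ε : ℝ, 0 < c → 0 < ε → ε < 1 → ∀ j : ℕ, ∃ A : ℝ, ∀ t : ℝ, 0 ≤ t → ∀ w : Site 4,
        elen w ^ j * gaussProfile c t w ≤ A * Real.sqrt (1 + t) ^ j * gaussProfile ((1 - ε) * c) t w) ∧
      (∀ c ε : ℝ, 0 < c → 0 < ε → ε < 1 → ∃ A : ℝ, ∀ t : ℝ, 0 ≤ t → ∀ w z : Site 4, elen z ≤ 2 →
        gaussProfile c t (w + z) ≤ A * gaussProfile ((1 - ε) * c) t w) ∧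
      (∀ c : ℝ, 0 < c → ∃ A : ℝ, ∀ t : ℝ, 0 ≤ t →
        Summable (fun y : Site 4 => gaussProfile c t y) ∧ ∑' y : Site 4, gaussProfile c t y ≤ A) ∧
      (∀ c : ℝ, 0 < c → ∃ C : ℝ, ∀ (L : ℕ), 1 ≤ L → ∀ t : ℝ, 1 ≤ t → t ≤ (L : ℝ) ^ 2 →
        Summable (fun n : Site 4 => gaussProfile c t (fun μ => (L : ℤ) * n μ)) ∧
        ∑' n : Site 4, (if n = 0 then 0 else gaussProfile c t (fun μ => (L : ℤ) * n μ)) ≤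
          C * Real.exp (-(c / 2 * (L : ℝ) ^ 2 / (t + (L : ℝ)))) / t ^ 2)) :=
  ⟨FreeMajorantToolkit.stub_freeMajorantToolkitAuxF, FreeMajorantToolkit.stub_freeMajorantToolkitAuxC,
    FreeMajorantToolkit.stub_freeMajorantToolkitAuxB⟩

end Summit.QuantumFields.QCD.Cruxes.QuarkLoopCoefficient.Sketch
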